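import Mathlib.Topology.Covering.Basic
import Literature.AlgebraicTopology.SingularHomology.FiniteDeckTransfer
import HarnessLib

/-!
# The transfer of a finite regular covering, II: `p^* ∘ τ^* = Σ_g g^*` and deck invariance

Complements to `FiniteDeckTransfer` (A. Hatcher, *Algebraic Topology* (2002), §3.G p. 321: for an
`n`-sheeted covering `π : X̃ → X` the transfer `τ` "assigns to a singular simplex `σ : Δᵏ → X` the sum
of the `n` distinct lifts `σ̃`"; there the identity `τ^* π^* = |G|` was proved). Here, for a finite
regular covering `c : FiniteDeckCover G E B` (deck group `G`) and any commutative coefficient ring: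

* `FiniteDeckCover.map_f_transferCochain_apply`, `transfer_comp_map_proj` — **`p^♯(τψ) = Σ_{g ∈ G} g^♯ψ`**
  on cochains (read Hatcher's formula upstairs: `(τψ)(p ∘ a) = Σ_g ψ(g ∘ a)`), and
  `map_proj_transferMap` — **`p^*(τ^* y) = Σ_{g ∈ G} g^* y` on `Hⁿ(E; R)`**;
* `transferCochain_map_f_deck`, `transferMap_map_deck` — **`τ^* ∘ g^* = τ^*`** (the orbit sum is
  invariant under the deck group);
* `isCoveringMap_homeomorph` — a homeomorphism is a (one-sheeted) covering map (used to run the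
  transfer on trivial covers).

These are the two halves of the classical description of Hecke operators / double coset actions on the
cohomology of quotients `Γ \ 𝔹` as `τ ∘ q^*` (consumer: `AlgebraicGeometry/ShimuraVarieties/
HeckeCorrespondenceAction`). All proved; no named facts, no instances.

## References

* [HatcherAT2002] A. Hatcher, Algebraic Topology, CUP 2002, §3.G p. 321 (transfer homomorphisms),
  §1.3 (deck transformations).
-/

noncomputable section

open CategoryTheory

universe u v w

/-! ### Complements on the transfer of a finite regular covering -/

namespace Literature.AlgebraicTopology.SingularHomology

namespace FiniteDeckCover

variable {G : Type w} [Group G] [Fintype G] {E B : Type u} [TopologicalSpace E] [TopologicalSpace B]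
  [MulAction G E] (c : FiniteDeckCover G E B) {n : ℕ} {R : Type v} [CommRing R]

/-- Evaluating a finite sum of morphisms of `R`-modules. [folklore] -/
theorem moduleCat_sum_apply {S : Type*} [Ring S] {M N : ModuleCat S} {ι : Type*} (s : Finset ι)
    (f : ι → (M ⟶ N)) (x : M) : (∑ i ∈ s, f i) x = ∑ i ∈ s, f i x := by
  change (∑ i ∈ s, f i).hom x = ∑ i ∈ s, (f i).hom x
  rw [ModuleCat.hom_sum, LinearMap.coe_sum, Finset.sum_apply]

/-- **`p^♯ (τ ψ) = Σ_g g^♯ ψ`** on cochains: pulling the transfer back to the cover gives the sum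
over the deck group (`(τψ)(p ∘ a) = Σ_g ψ(g ∘ a)`). [cite: HatcherAT2002, §3.G p. 321] -/
theorem map_f_transferCochain_apply (ψ : SingularSimplex E n → R) (a : SingularSimplex E n) :
    (singularCochainComplex.map R R c.proj).f n (c.transferCochain n ψ) a =
      ∑ g : G, ψ (a.map (c.deck g)) := by
  rw [singularCochainComplex.map_apply, transferCochain_apply_map_proj, orbitSum]

/-- **`τ ≫ p^♯ = Σ_g g^♯`** as morphisms of cochain complexes. [cite: HatcherAT2002, §3.G p. 321] -/
theorem transfer_comp_map_proj :
    c.transfer (R := R) ≫ singularCochainComplex.map R R c.proj =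
      ∑ g : G, singularCochainComplex.map R R (c.deck g) := by
  refine HomologicalComplex.hom_ext _ _ fun n => ModuleCat.hom_ext (LinearMap.ext fun ψ => ?_)
  have hf : (∑ g : G, singularCochainComplex.map R R (c.deck g)).f n =
      ∑ g : G, (singularCochainComplex.map R R (c.deck g)).f n :=
    map_sum (HomologicalComplex.Hom.fAddMonoidHom n) _ _
  change (singularCochainComplex.map R R c.proj).f n (c.transferCochain n ψ) =
    (∑ g : G, singularCochainComplex.map R R (c.deck g)).f n ψ
  rw [hf, moduleCat_sum_apply]
  funext a
  rw [c.map_f_transferCochain_apply ψ a]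
  refine ((Finset.sum_apply (M := fun _ : SingularSimplex E n => R) a Finset.univ
    fun g => (singularCochainComplex.map R R (c.deck g)).f n ψ).trans ?_).symm
  rfl

/-- **`p^* (τ^* y) = Σ_{g ∈ G} g^* y` on `Hⁿ(E; R)`**: the pull-back of the transfer of a class to
the cover is the sum of its translates under the deck group (Hatcher 2002, §3.G, the formula
`(τφ)(σ) = Σ φ(σ̃)` read upstairs). [cite: HatcherAT2002, §3.G p. 321] -/
theorem map_proj_transferMap (n : ℕ) (y : singularCohomology R R E n) :
    singularCohomology.map R R c.proj n (c.transferMap n y) =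
      ∑ g : G, singularCohomology.map R R (c.deck g) n y := by
  change (HomologicalComplex.homologyMap c.transfer n ≫
    HomologicalComplex.homologyMap (singularCochainComplex.map R R c.proj) n) y = _
  rw [← HomologicalComplex.homologyMap_comp, c.transfer_comp_map_proj]
  change (HomologicalComplex.homologyFunctor (ModuleCat R) (ComplexShape.up ℕ) n).map
    (∑ g : G, singularCochainComplex.map R R (c.deck g)) y = _
  rw [Functor.map_sum, moduleCat_sum_apply]
  rfl

/-- The transfer on cochains is invariant under deck transformations: `τ(g^♯ ψ) = τ ψ` (reindex the
orbit sum). [cite: HatcherAT2002, §3.G p. 321] -/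
theorem transferCochain_map_f_deck (g : G) (ψ : SingularSimplex E n → R) :
    c.transferCochain n ((singularCochainComplex.map R R (c.deck g)).f n ψ) =
      c.transferCochain n ψ := by
  funext σ
  simp only [transferCochain_apply, orbitSum, singularCochainComplex.map_apply, map_deck_map_deck]
  exact Fintype.sum_equiv (Equiv.mulLeft g) _ _ fun h => rfl

/-- **`τ^* ∘ g^* = τ^*`**: the transfer in cohomology is invariant under the deck group.
[cite: HatcherAT2002, §3.G p. 321] -/
theorem transferMap_map_deck (n : ℕ) (g : G) (y : singularCohomology R R E n) :
    c.transferMap n (singularCohomology.map R R (c.deck g) n y) = c.transferMap n y := by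
  have h : singularCochainComplex.map R R (c.deck g) ≫ c.transfer (R := R) = c.transfer := by
    refine HomologicalComplex.hom_ext _ _ fun n => ModuleCat.hom_ext (LinearMap.ext fun ψ => ?_)
    exact c.transferCochain_map_f_deck g ψ
  change (HomologicalComplex.homologyMap (singularCochainComplex.map R R (c.deck g)) n ≫
    HomologicalComplex.homologyMap c.transfer n) y = _
  rw [← HomologicalComplex.homologyMap_comp, h]
  rfl

end FiniteDeckCover

/-- A homeomorphism is a (one-sheeted) covering map. [folklore] -/
theorem isCoveringMap_homeomorph {E B : Type*} [TopologicalSpace E] [TopologicalSpace B]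
    (e : E ≃ₜ B) : IsCoveringMap e :=
  IsCoveringMap.mk e (fun _ => PUnit.{1}) (fun _ =>
    { toOpenPartialHomeomorph :=
        (e.trans (Homeomorph.prodPUnit B).symm : E ≃ₜ B × PUnit.{1}).toOpenPartialHomeomorph
      baseSet := Set.univ
      open_baseSet := isOpen_univ
      source_eq := Set.preimage_univ.symm
      target_eq := Set.univ_prod_univ.symm
      proj_toFun := fun _ _ => rfl }) fun _ => Set.mem_univ _

end Literature.AlgebraicTopology.SingularHomology

end
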